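import Mathlib
import Summits.ResolutionOfSingularities.ResolutionOfSingularities.Theorems.WildQuotientsWildQuotientResolutionBlowupExitConeTransfer
import Summits.ResolutionOfSingularities.ResolutionOfSingularities.Theorems.WildQuotientsWildQuotientResolutionBlowupExitVertexLocus

/-!
# Cone bricks from a vertex presentation: the scheme → ring reduction of `HPa` / `HP₀` / `HP₁`
(crux stmt-ResolutionOfSingularities-15640 `WildQuotients.WildQuotientResolution`, line `Sketch`;
chain w45c programmes V3U/V4U, `L/w45c/CHAIN.md` v7 §4 (scaffolds p496627 / p501160; RULING v6.3 (3)
layering «scaffold ← E discharges ← algebra packages»); [OURS · L1 W4.5c] — generic glue, NOT a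
statement of any manuscript.)

`BlowupExit.exists_isBlowup_regular_of_vertexPresentation` combines the cone-brick transfer
(`exists_isBlowup_regular_of_invariantsPresentation`, p503610) with the equations of the vertex loci
(`preimage_ι_vertexLocus_eq_zeroLocus_spec`, p504270). Setting: `π : V → Spec S` a blowing up along
`I`, `q : Spec S → Y` with `Y` affine, an action `ρB` of the finite group `G` on `V` over `Y`, a
`G`-stable open `O`, affine over `Y`, inside a principal chart `V[⊤, u]`, the «other» charts
`V[⊤, y_j]`, the fixed locus `V(F₀) ⊆ Spec S` (`F₀ ⊆ S`), and the closed image `Z ⊆ O/G` of the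
vertex locus `T = π⁻¹V(F₀) ∖ ⋃_j V[⊤, y_j]` — LITERALLY the shape of the cone-brick binders `HPa`
(p496627) and `HP₀`, `HP₁` (p501160). CONCLUSION: some blow-up of `O/G` along `𝓘_Z` is regular,
PROVIDED the ring-level brick `H`: for the chart ratios `T_j = π^*y_j / π^*u` there is a
presentation `ψ : R₀ → Γ(O)` of the invariant ring (injective, `range ψ = Γ(O)^G`) and a radical
ideal `J₀ ⊆ R₀` with regular affine blow-up such that `√(ψ⁻¹(𝔞 Γ(O))) = J₀`, where
`𝔞 = {π^*f | f ∈ F₀} ∪ {T_j}` restricted to `O`. So the E-row dischargers never touch `Z`, the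
quotient map or the blow-up: only chart rings, the action on them, and one radical identity.
-/

-- single-problem summit: the doubled namespace component `ResolutionOfSingularities` is forced
set_option linter.dupNamespace false

noncomputable section

open CategoryTheory AlgebraicGeometry TopologicalSpace
open Literature.AlgebraicGeometry.Resolution Literature.AlgebraicGeometry.RelativeSpec

namespace Summit.ResolutionOfSingularities.ResolutionOfSingularities.Theorems.WildQuotientResolution.BlowupExit

/-- **Cone brick from a vertex presentation** (see the module docstring). [OURS · L1 W4.5c]
[folklore; assembly of landed decls] -/
theorem exists_isBlowup_regular_of_vertexPresentation {S : Type} [CommRing S] {V : Scheme.{0}}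
    {π : V ⟶ Spec (CommRingCat.of S)} {I : (Spec (CommRingCat.of S)).IdealSheafData}
    (hπ : IsBlowup π I) {Y : Scheme.{0}} (q : Spec (CommRingCat.of S) ⟶ Y) [IsAffine Y]
    {G : Type} [Group G] [Finite G] (ρB : ActionOver (π ≫ q) G) [IsSeparated (π ≫ q)]
    {u : Γ(Spec (CommRingCat.of S), ⊤)} (hu : u ∈ I.ideal ⟨⊤, isAffineOpen_top _⟩)
    {κ : Type*} (y : κ → Γ(Spec (CommRingCat.of S), ⊤))
    (hy : ∀ j, y j ∈ I.ideal ⟨⊤, isAffineOpen_top _⟩) (F₀ : Set S)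
    (O : ρB.StableAffineOpens) (hO : O.1 ≤ blowupChart π I ⟨⊤, isAffineOpen_top _⟩ u)
    (hle : ((O.1.ι ≫ π ≫ q) ⁻¹ᵁ ⊤ : (O.1 : Scheme.{0}).Opens) ≤
      O.1.ι ⁻¹ᵁ blowupChart π I ⟨⊤, isAffineOpen_top _⟩ u)
    (H : ∀ (T : κ → Γ(V, blowupChart π I ⟨⊤, isAffineOpen_top _⟩ u)),
      (∀ j, π.appLE ⊤ (blowupChart π I ⟨⊤, isAffineOpen_top _⟩ u)
          (blowupChart_le_preimage π I ⟨⊤, isAffineOpen_top _⟩ u) (y j) =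
        π.appLE ⊤ (blowupChart π I ⟨⊤, isAffineOpen_top _⟩ u)
          (blowupChart_le_preimage π I ⟨⊤, isAffineOpen_top _⟩ u) u * T j) →
      ∃ (R₀ : Type) (_ : CommRing R₀) (J₀ : Ideal R₀)
        (ψ : R₀ →+* Γ((O.1 : Scheme.{0}), (O.1.ι ≫ π ≫ q) ⁻¹ᵁ ⊤)),
        Function.Injective ψ ∧ ψ.range = (ρB.restrict O.1 O.2.1).invariantsRing ⊤ ∧
        J₀.IsRadical ∧ Scheme.IsRegular (affineBlowup J₀) ∧
        ((Ideal.span ((O.1.ι.appLE (blowupChart π I ⟨⊤, isAffineOpen_top _⟩ u)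
            ((O.1.ι ≫ π ≫ q) ⁻¹ᵁ ⊤) hle) ''
          ((π.appLE ⊤ (blowupChart π I ⟨⊤, isAffineOpen_top _⟩ u)
              (blowupChart_le_preimage π I ⟨⊤, isAffineOpen_top _⟩ u)) ''
            ((Scheme.ΓSpecIso (CommRingCat.of S)).inv '' F₀) ∪ Set.range T))).comap ψ).radical = J₀)
    (Z : Closeds (ρB.pieceQuot O))
    (hZ : (Z : Set (ρB.pieceQuot O)) = (ρB.pieceMk O).base ''
      (O.1.ι.base ⁻¹' ({v | π.base v ∈ PrimeSpectrum.zeroLocus F₀} \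
        ((⨆ j, blowupChart π I ⟨⊤, isAffineOpen_top _⟩ (y j) : V.Opens) : Set V)))) :
    ∃ (B : Scheme.{0}) (pB : B ⟶ ρB.pieceQuot O),
      IsBlowup pB (Scheme.IdealSheafData.vanishingIdeal Z) ∧ Scheme.IsRegular B := by
  classical
  haveI : Y.IsSeparated := inferInstance
  -- the chart ratios `T_j = π^*y_j / π^*u`
  have hT : ∀ j, ∃ T : Γ(V, blowupChart π I ⟨⊤, isAffineOpen_top _⟩ u),
      π.appLE ⊤ (blowupChart π I ⟨⊤, isAffineOpen_top _⟩ u)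
          (blowupChart_le_preimage π I ⟨⊤, isAffineOpen_top _⟩ u) (y j) =
        π.appLE ⊤ (blowupChart π I ⟨⊤, isAffineOpen_top _⟩ u)
          (blowupChart_le_preimage π I ⟨⊤, isAffineOpen_top _⟩ u) u * T :=
    fun j => hπ.exists_chartRatio ⟨⊤, isAffineOpen_top _⟩ hu (hy j)
  choose T hT using hT
  obtain ⟨R₀, _, J₀, ψ, hψ, hrange, hJ₀, hreg, hJ⟩ := H T hT
  -- the vertex locus seen in `O` is the zero locus of `𝔞`
  have hU' : ((O.1.ι ≫ π ≫ q) ⁻¹ᵁ ⊤ : (O.1 : Scheme.{0}).Opens) = ⊤ := Scheme.Hom.preimage_top _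
  have hZ' := hZ
  rw [preimage_ι_vertexLocus_eq_zeroLocus_spec hπ hu y hy T hT F₀ O.1 hO _ hU' hle] at hZ'
  exact exists_isBlowup_regular_of_invariantsPresentation ρB O ψ hψ hrange _ J₀ hJ₀ hJ hreg Z hZ'

end Summit.ResolutionOfSingularities.ResolutionOfSingularities.Theorems.WildQuotientResolution.BlowupExit

end
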